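import Summits.CriticalPhenomena.PercolationContinuityZ3.Theorems.PercNearOneGluingAdditiveGluingBlockGoodThreeRelaysConvex
import HarnessLib

/-! # Crux `PercNearOneGluing.AdditiveGluing` (stmt-CriticalPhenomena-4576), stub `stub_goodStep` — the residual kernel with
# THREE relays: one set-observer exchange suffices whenever the block rarely captures one relay without the target

TTRL deep seat (variant V1357 = the hypothesis `hres` of the landed capstone `goodStep_of_residualKernel`); lands
`--supports stmt-CriticalPhenomena-4576`; no definitions, no named facts.  Companion of
`blockGood_threeRelays_of_convexCapture` (same seat): there the chain `a₀ → a₁ → a₂` of TWO Lemma-3 exchanges pays for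
everything except the non-convex capture mass; here a SINGLE exchange `a₀ → a₁` is made and the leftover is charged
directly to `μ(b ∈ K_S; a₀, a₁ ∉ K_S)`.

**Theorem (`blockGood_threeRelays_of_captureControl`).**  `μ = prodBernoulli u`; relays `A ⊆ {a₀, a₁, a₂, b}` with
`b, a₀, a₁, a₂ ∈ A`; `a₀` a minimiser of `μ(· ↔ b)` over `A` (NO order between `a₁, a₂` is needed, so the theorem can be
used with either labelling); `S ≠ ∅` any block, `K_S = ⋃_{s∈S} C(s)`, `fᵢ(W) = μ(K_S = W, aᵢ ↔ b)`; `sel W ∈ A`.  If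
`μ(a₁ ↔ b; a₂ ∈ K_S; a₀, a₁, b ∉ K_S) + Σ_{W ∩ A = ∅} (min(f₀ W, f₁ W) − f₂ W)⁺ ≤ μ(b ∈ K_S; a₀, a₁ ∉ K_S)`
("the block captures the relay `a₂` WITHOUT the target while `a₁` reaches the target, or makes `a₂` the locally worst
relay off a dead pocket, no more often than it captures the target missing `a₀, a₁`"), then the residual kernel holds:
`μ(a₀ ↔ b) + μ(a₀ ↮ b, a₀ ↔ S, S ↔ b) ≤ μ(S ↔ b) + Σ_{W ∩ A = ∅} μ(K_S = W) · μ(sel W ↔ b in Wᶜ)`.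
Numerically (exact enumeration, seat lab): with `a₂` the MOST reliable relay the hypothesis holds in about 98 per cent
of random weighted `K₇` instances and in about 87 per cent of the tightest decile of the kernel (against about 20 per
cent for the convex-capture chain); the irreducible residue of V1357 is thus the regime where the block's cluster
captures the best relay without the target while the second relay reaches the target.
Proof: exchange normal form at `a₀`; Kozma–Nitzan's Lemma 3 for the observer SET `S` (`SandwichSet.lemma3_sandwich_set`)
with the family `{T ∌ a₀ | a₁ ∈ T ∨ (a₂ ∈ T ∌ b)} ∪ {dead W : f₁ < f₀}`; pocket identity
`f₀ = min(f₀,f₁,f₂) + (f₀ − f₁)⁺ + (min(f₀,f₁) − f₂)⁺`.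
[cite: KozmaNitzan2024, §3.2 (Definition p. 12, Thms 4–5 pp. 12–14, Question 7 p. 36), Lemma 3 (pp. 6–7)]
-/

namespace Summit.CriticalPhenomena.PercolationContinuityZ3.Theorems

open MeasureTheory Set
open Literature.Probability.LatticeModels (prodBernoulli)
open Literature.Probability.Percolation (BondConfig openConn openConnIn openGraph openCluster)
open scoped BigOperators

noncomputable section
open Classical

section BlockGoodThreeRelaysCapture

open Literature.Probability.LatticeModels Literature.Probability.Percolation

variable {n : ℕ}

/-- **The residual kernel with three relays under capture control of one relay.**  See the module docstring.
[cite: KozmaNitzan2024, §3.2 (Definition p. 12, Question 7 p. 36), Lemma 3 (pp. 6–7)] -/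
theorem blockGood_threeRelays_of_captureControl (u : Sym2 (Fin n) → unitInterval) (A S : Finset (Fin n))
    (b a₀ a₁ a₂ : Fin n) (sel : Finset (Fin n) → Fin n)
    (hbA : b ∈ A) (ha₀ : a₀ ∈ A) (ha₁ : a₁ ∈ A) (ha₂ : a₂ ∈ A)
    (hA : ∀ a ∈ A, a = a₀ ∨ a = a₁ ∨ a = a₂ ∨ a = b) (hS : S.Nonempty)
    (hsel : ∀ W, sel W ∈ A)
    (hmin : ∀ a ∈ A, (prodBernoulli u).real (openConn a₀ b) ≤ (prodBernoulli u).real (openConn a b))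
    (hcap : (prodBernoulli u).real (openConn a₁ b ∩ (⋃ s ∈ S, openConn s b)ᶜ ∩ (⋃ s ∈ S, openConn s a₂)
          ∩ (⋃ s ∈ S, openConn s a₁)ᶜ ∩ (⋃ s ∈ S, openConn s a₀)ᶜ)
        + ∑ W ∈ (Finset.univ : Finset (Finset (Fin n))).filter (fun W => Disjoint W A),
            max (min ((prodBernoulli u).real ({ω : BondConfig (Fin n) | ∀ z : Fin n, (z ∈ W ↔ ω ∈ ⋃ s ∈ S, openConn s z)}
                        ∩ openConn a₀ b))
                      ((prodBernoulli u).real ({ω : BondConfig (Fin n) | ∀ z : Fin n, (z ∈ W ↔ ω ∈ ⋃ s ∈ S, openConn s z)}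
                        ∩ openConn a₁ b))
                  - (prodBernoulli u).real ({ω : BondConfig (Fin n) | ∀ z : Fin n, (z ∈ W ↔ ω ∈ ⋃ s ∈ S, openConn s z)}
                        ∩ openConn a₂ b)) 0
        ≤ (prodBernoulli u).real ((⋃ s ∈ S, openConn s b) ∩ (⋃ s ∈ S, openConn s a₀)ᶜ
            ∩ (⋃ s ∈ S, openConn s a₁)ᶜ)) :
    (prodBernoulli u).real (openConn a₀ b)
        + (prodBernoulli u).real
            ((openConn a₀ b)ᶜ ∩ (⋃ s ∈ S, openConn a₀ s) ∩ (⋃ s ∈ S, openConn s b))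
      ≤ (prodBernoulli u).real (⋃ s ∈ S, openConn s b)
        + ∑ W ∈ (Finset.univ : Finset (Finset (Fin n))).filter (fun W => Disjoint W A),
            (prodBernoulli u).real {ω : BondConfig (Fin n) | ∀ z : Fin n, (z ∈ W ↔ ω ∈ ⋃ s ∈ S, openConn s z)}
              * (prodBernoulli u).real (openConnIn ((W : Set (Fin n))ᶜ) (sel W) b) := by
  set μ := prodBernoulli u with hμ
  have hms : ∀ s : Set (BondConfig (Fin n)), MeasurableSet s := fun _ => MeasurableSet.of_discrete
  -- notation
  set KW : Finset (Fin n) → Set (BondConfig (Fin n)) :=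
    fun W => {ω : BondConfig (Fin n) | ∀ z : Fin n, (z ∈ W ↔ ω ∈ ⋃ s ∈ S, openConn s z)} with hKW
  set Y : Set (BondConfig (Fin n)) := ⋃ s ∈ S, openConn s b with hY
  set Xs : Set (BondConfig (Fin n)) := ⋃ s ∈ S, openConn a₀ s with hXs
  set X₀ : Set (BondConfig (Fin n)) := ⋃ s ∈ S, openConn s a₀ with hX₀
  set X₁ : Set (BondConfig (Fin n)) := ⋃ s ∈ S, openConn s a₁ with hX₁
  set X₂ : Set (BondConfig (Fin n)) := ⋃ s ∈ S, openConn s a₂ with hX₂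
  set 𝒟 : Finset (Finset (Fin n)) := (Finset.univ : Finset (Finset (Fin n))).filter (fun W => Disjoint W A) with h𝒟
  set f₀ : Finset (Fin n) → ℝ := fun W => μ.real (KW W ∩ openConn a₀ b) with hf₀
  set f₁ : Finset (Fin n) → ℝ := fun W => μ.real (KW W ∩ openConn a₁ b) with hf₁
  set f₂ : Finset (Fin n) → ℝ := fun W => μ.real (KW W ∩ openConn a₂ b) with hf₂
  have hXs' : Xs = X₀ := by
    simp only [hXs, hX₀, knThm2_openConn_comm a₀]
  have hmemXs : ∀ ω, ω ∈ Xs ↔ ∃ s ∈ S, (openGraph ω).Reachable a₀ s := fun ω => by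
    simp only [hXs, Set.mem_iUnion, exists_prop]; exact Iff.rfl
  have hmemY : ∀ ω, ω ∈ Y ↔ ∃ s ∈ S, (openGraph ω).Reachable s b := fun ω => by
    simp only [hY, Set.mem_iUnion, exists_prop]; exact Iff.rfl
  have hmemX₀ : ∀ ω, ω ∈ X₀ ↔ ∃ s ∈ S, (openGraph ω).Reachable s a₀ := fun ω => by
    simp only [hX₀, Set.mem_iUnion, exists_prop]; exact Iff.rfl
  have hmemX₁ : ∀ ω, ω ∈ X₁ ↔ ∃ s ∈ S, (openGraph ω).Reachable s a₁ := fun ω => by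
    simp only [hX₁, Set.mem_iUnion, exists_prop]; exact Iff.rfl
  have hmemX₂ : ∀ ω, ω ∈ X₂ ↔ ∃ s ∈ S, (openGraph ω).Reachable s a₂ := fun ω => by
    simp only [hX₂, Set.mem_iUnion, exists_prop]; exact Iff.rfl
  have hK : ∀ (ω : BondConfig (Fin n)) (a : Fin n),
      (a ∈ ⋃ o ∈ S, openCluster ω o) ↔ ∃ o ∈ S, (openGraph ω).Reachable o a :=
    fun ω a => SandwichSet.mem_kUnion_iff ω S a
  have hmem𝒟 : ∀ W, W ∈ 𝒟 ↔ Disjoint W A := fun W => by simp [h𝒟]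
  -- (S1) each pocket term is at least `min (min f₀ f₁) f₂`
  have hterm : ∀ W ∈ 𝒟, min (min (f₀ W) (f₁ W)) (f₂ W) ≤
      μ.real (KW W) * μ.real (openConnIn ((W : Set (Fin n))ᶜ) (sel W) b) := by
    intro W hW
    have hWA : Disjoint W A := (hmem𝒟 W).1 hW
    have hselW : sel W ∉ W := fun h => Finset.disjoint_left.1 hWA h (hsel W)
    rw [show μ.real (KW W) * μ.real (openConnIn ((W : Set (Fin n))ᶜ) (sel W) b) = μ.real (KW W ∩ openConn (sel W) b)
      from blockPocket_mul_offConn u S W hS (sel W) b hselW]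
    rcases hA (sel W) (hsel W) with h | h | h | h
    · rw [h]; exact (min_le_left _ _).trans (min_le_left _ _)
    · rw [h]; exact (min_le_left _ _).trans (min_le_right _ _)
    · rw [h]; exact min_le_right _ _
    · rw [h]
      refine ((min_le_left _ _).trans (min_le_left _ _)).trans
        (measureReal_mono (Set.inter_subset_inter_right _ fun ω _ => ?_) (measure_ne_top _ _))
      exact (SimpleGraph.Reachable.refl b : (openGraph ω).Reachable b b)
  have hsum1 : ∑ W ∈ 𝒟, min (min (f₀ W) (f₁ W)) (f₂ W) ≤
      ∑ W ∈ 𝒟, μ.real (KW W) * μ.real (openConnIn ((W : Set (Fin n))ᶜ) (sel W) b) := Finset.sum_le_sum hterm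
  -- (S2) the dead part of `τ(a₀)` is the fibre sum of `f₀`
  have hP3 : μ.real (openConn a₀ b ∩ Yᶜ ∩ (X₁ ∪ X₂)ᶜ) = ∑ W ∈ 𝒟, f₀ W := by
    have h := blockPocket_sum_dead u S A (openConn a₀ b)
    simp only [hf₀, h𝒟, hKW]
    rw [h]
    congr 1; ext ω
    simp only [Set.mem_inter_iff, Set.mem_compl_iff, Set.mem_union, Set.mem_setOf_eq, hmemY, hmemX₁, hmemX₂,
      Set.mem_iUnion, exists_prop, not_exists, not_and, not_or]
    constructor
    · rintro ⟨⟨hab, hYc⟩, hX1c, hX2c⟩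
      refine ⟨hab, fun a ha s hs hsa => ?_⟩
      rcases hA a ha with rfl | rfl | rfl | rfl
      · exact hYc s hs (hsa.trans hab)
      · exact hX1c s hs hsa
      · exact hX2c s hs hsa
      · exact hYc s hs hsa
    · rintro ⟨hab, hdead⟩
      exact ⟨⟨hab, fun s hs hsb => hdead b hbA s hs hsb⟩, fun s hs hsa => hdead a₁ ha₁ s hs hsa,
        fun s hs hsa => hdead a₂ ha₂ s hs hsa⟩
  -- (S3) `τ(a₀) = P1 + A1 + P3`
  have hτ : μ.real (openConn a₀ b) = μ.real (openConn a₀ b ∩ Y) + μ.real (openConn a₀ b ∩ Yᶜ ∩ (X₁ ∪ X₂))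
      + μ.real (openConn a₀ b ∩ Yᶜ ∩ (X₁ ∪ X₂)ᶜ) := by
    have e1 := measureReal_inter_add_sdiff (μ := μ) (s := openConn a₀ b) (hms Y) (measure_ne_top _ _)
    have e2 := measureReal_inter_add_sdiff (μ := μ) (s := openConn a₀ b ∩ Yᶜ) (hms (X₁ ∪ X₂)) (measure_ne_top _ _)
    rw [Set.sdiff_eq] at e1 e2
    linarith
  -- (S4) `μ(Y) = Q1 + Q2 + Q3`
  have hYd : μ.real Y = μ.real (openConn a₀ b ∩ Y)
      + μ.real ((openConn a₀ b)ᶜ ∩ Xs ∩ Y) + μ.real (Y ∩ (openConn a₀ b)ᶜ ∩ Xsᶜ) := by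
    have e1 := measureReal_inter_add_sdiff (μ := μ) (s := Y) (hms (openConn a₀ b)) (measure_ne_top _ _)
    have e2 := measureReal_inter_add_sdiff (μ := μ) (s := Y ∩ (openConn a₀ b)ᶜ) (hms Xs) (measure_ne_top _ _)
    rw [Set.sdiff_eq] at e1 e2
    rw [Set.inter_comm Y (openConn a₀ b)] at e1
    have e3 : Y ∩ (openConn a₀ b)ᶜ ∩ Xs = (openConn a₀ b)ᶜ ∩ Xs ∩ Y := by
      ext ω; simp only [Set.mem_inter_iff]; tauto
    rw [e3] at e2
    linarith
  -- (S5) `Q3 ≥ μ(b ∈ K_S, a₀ ∉ K_S)`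
  have hQ3 : μ.real (Y ∩ X₀ᶜ) ≤ μ.real (Y ∩ (openConn a₀ b)ᶜ ∩ Xsᶜ) := by
    rw [hXs']
    refine measureReal_mono (fun ω hω => ?_) (measure_ne_top _ _)
    simp only [Set.mem_inter_iff, Set.mem_compl_iff, hmemY, hmemX₀, not_exists, not_and] at hω ⊢
    obtain ⟨⟨s, hs, hsb⟩, hX0c⟩ := hω
    exact ⟨⟨⟨s, hs, hsb⟩, fun hab => hX0c s hs (hsb.trans (show (openGraph ω).Reachable a₀ b from hab).symm)⟩, hX0c⟩
  -- (S6) Lemma 3 for the observer set `S`, chain step `a₀ → a₁`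
  set R₁ : Finset (Finset (Fin n)) := 𝒟.filter (fun W => f₁ W < f₀ W) with hR₁
  have hR₁A : ∀ W ∈ R₁, Disjoint W A := fun W hW => (hmem𝒟 W).1 (Finset.mem_filter.1 hW).1
  set Q₁ : Set (Fin n) → Prop := fun T => a₀ ∉ T ∧ (a₁ ∈ T ∨ (a₂ ∈ T ∧ b ∉ T)) with hQ₁
  have hR₁Q : ∀ W : Finset (Fin n), W ∈ R₁ → ¬ Q₁ (W : Set (Fin n)) := by
    rintro W hW ⟨-, h1 | ⟨h2, -⟩⟩
    · exact Finset.disjoint_left.1 (hR₁A W hW) (Finset.mem_coe.1 h1) ha₁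
    · exact Finset.disjoint_left.1 (hR₁A W hW) (Finset.mem_coe.1 h2) ha₂
  set 𝓕₁ : Set (Set (Fin n)) := {T : Set (Fin n) | Q₁ T} ∪ {T | ∃ W ∈ R₁, T = (W : Set (Fin n))} with h𝓕₁
  have hlo₁ : ∀ ω : BondConfig (Fin n), a₁ ∈ (⋃ s ∈ S, openCluster ω s) → a₀ ∉ (⋃ s ∈ S, openCluster ω s) →
      (⋃ s ∈ S, openCluster ω s) ∈ 𝓕₁ := fun ω h1 h0 => Or.inl ⟨h0, Or.inl h1⟩
  have hhi₁ : ∀ ω : BondConfig (Fin n), (⋃ s ∈ S, openCluster ω s) ∈ 𝓕₁ → a₀ ∉ (⋃ s ∈ S, openCluster ω s) := by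
    rintro ω (⟨h0, -⟩ | ⟨W, hW, hWe⟩)
    · exact h0
    · rw [hWe]
      exact fun h => Finset.disjoint_left.1 (hR₁A W hW) (Finset.mem_coe.1 h) ha₀
  have hsand₁ := SandwichSet.lemma3_sandwich_set u a₀ a₁ b S 𝓕₁ hlo₁ hhi₁ (hmin a₁ ha₁)
  have hpart₁₀ := real_inter_blockFamilyPred u S Q₁ R₁ hR₁Q (openConn a₀ b)
  have hpart₁₁ := real_inter_blockFamilyPred u S Q₁ R₁ hR₁Q (openConn a₁ b)
  rw [hpart₁₀, hpart₁₁] at hsand₁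
  -- `hsand₁ : μ(a₀b ∩ {Q₁ K}) + Σ_{R₁} f₀ ≤ μ(a₁b ∩ {Q₁ K}) + Σ_{R₁} f₁`
  -- lower bound of the left bottom: `A1 ≤ μ(a₀b ∩ {Q₁ K})`
  have hA1 : μ.real (openConn a₀ b ∩ Yᶜ ∩ (X₁ ∪ X₂)) ≤
      μ.real (openConn a₀ b ∩ {ω | Q₁ (⋃ s ∈ S, openCluster ω s)}) := by
    refine measureReal_mono (fun ω hω => ?_) (measure_ne_top _ _)
    simp only [Set.mem_inter_iff, Set.mem_compl_iff, Set.mem_union, hmemY, hmemX₁, hmemX₂, not_exists, not_and]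
      at hω
    obtain ⟨⟨hab, hYc⟩, hX⟩ := hω
    refine ⟨hab, ?_, ?_⟩
    · intro h0
      obtain ⟨s, hs, hs0⟩ := (hK ω a₀).1 h0
      exact hYc s hs (hs0.trans hab)
    · rcases hX with ⟨s, hs, hs1⟩ | ⟨s, hs, hs2⟩
      · exact Or.inl ((hK ω a₁).2 ⟨s, hs, hs1⟩)
      · refine Or.inr ⟨(hK ω a₂).2 ⟨s, hs, hs2⟩, fun hb => ?_⟩
        obtain ⟨s', hs', hs'b⟩ := (hK ω b).1 hb
        exact hYc s' hs' hs'b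
  -- upper bound of the right bottom: `μ(a₁b ∩ {Q₁ K}) ≤ μ(Y ∩ X₁ ∩ X₀ᶜ) + μ(V₀)`
  set V₀ : Set (BondConfig (Fin n)) := openConn a₁ b ∩ Yᶜ ∩ X₂ ∩ X₁ᶜ ∩ X₀ᶜ with hV₀
  have hU₁ : μ.real (openConn a₁ b ∩ {ω | Q₁ (⋃ s ∈ S, openCluster ω s)}) ≤
      μ.real (Y ∩ X₁ ∩ X₀ᶜ) + μ.real V₀ := by
    refine (measureReal_mono (fun ω hω => ?_) (measure_ne_top _ _)).trans (measureReal_union_le _ _)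
    simp only [Set.mem_inter_iff, Set.mem_setOf_eq] at hω
    obtain ⟨h1b, h0, hor⟩ := hω
    have h0' : ω ∉ X₀ := fun h => by
      obtain ⟨s, hs, hs0⟩ := (hmemX₀ ω).1 h
      exact h0 ((hK ω a₀).2 ⟨s, hs, hs0⟩)
    by_cases h1 : a₁ ∈ ⋃ s ∈ S, openCluster ω s
    · obtain ⟨s, hs, hs1⟩ := (hK ω a₁).1 h1
      refine Or.inl ⟨⟨(hmemY ω).2 ⟨s, hs, hs1.trans h1b⟩, (hmemX₁ ω).2 ⟨s, hs, hs1⟩⟩, h0'⟩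
    · rcases hor with h1' | ⟨h2, hb⟩
      · exact absurd h1' h1
      · refine Or.inr ⟨⟨⟨⟨h1b, fun hYω => ?_⟩, ?_⟩, fun hX1 => ?_⟩, h0'⟩
        · obtain ⟨s, hs, hsb⟩ := (hmemY ω).1 hYω
          exact hb ((hK ω b).2 ⟨s, hs, hsb⟩)
        · obtain ⟨s, hs, hs2⟩ := (hK ω a₂).1 h2
          exact (hmemX₂ ω).2 ⟨s, hs, hs2⟩
        · obtain ⟨s, hs, hs1⟩ := (hmemX₁ ω).1 hX1
          exact h1 ((hK ω a₁).2 ⟨s, hs, hs1⟩)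
  -- (S8) pocket arithmetic: `Σ_𝒟 f₀ ≤ Σ_𝒟 min₃ + Σ_{R₁} (f₀ − f₁) + Σ_𝒟 (min(f₀,f₁) − f₂)⁺`
  have hS8 : ∑ W ∈ 𝒟, f₀ W ≤ ∑ W ∈ 𝒟, min (min (f₀ W) (f₁ W)) (f₂ W)
      + (∑ W ∈ R₁, f₀ W - ∑ W ∈ R₁, f₁ W) + ∑ W ∈ 𝒟, max (min (f₀ W) (f₁ W) - f₂ W) 0 := by
    have hpt : ∀ W, f₀ W ≤ min (min (f₀ W) (f₁ W)) (f₂ W)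
        + (if f₁ W < f₀ W then f₀ W - f₁ W else 0) + max (min (f₀ W) (f₁ W) - f₂ W) 0 := by
      intro W
      have h01 : f₀ W ≤ min (f₀ W) (f₁ W) + (if f₁ W < f₀ W then f₀ W - f₁ W else 0) := by
        by_cases h1 : f₁ W < f₀ W
        · rw [if_pos h1, min_eq_right h1.le]; linarith
        · rw [if_neg h1, min_eq_left (not_lt.1 h1)]; linarith
      by_cases h2 : f₂ W ≤ min (f₀ W) (f₁ W)
      · rw [min_eq_right h2, max_eq_left (sub_nonneg.2 h2)]; linarith
      · push Not at h2
        rw [min_eq_left h2.le, max_eq_right (by linarith)]; linarith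
    have hR₁sum : ∑ W ∈ R₁, f₀ W - ∑ W ∈ R₁, f₁ W = ∑ W ∈ 𝒟, (if f₁ W < f₀ W then f₀ W - f₁ W else 0) := by
      rw [← Finset.sum_sub_distrib, hR₁, Finset.sum_filter]
    rw [hR₁sum, ← Finset.sum_add_distrib, ← Finset.sum_add_distrib]
    exact Finset.sum_le_sum fun W _ => hpt W
  -- (S9) the bookkeeping of the `Y`-events
  have d1 : μ.real (Y ∩ X₀ᶜ) = μ.real (Y ∩ X₁ ∩ X₀ᶜ) + μ.real (Y ∩ X₀ᶜ ∩ X₁ᶜ) := by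
    have e := measureReal_inter_add_sdiff (μ := μ) (s := Y ∩ X₀ᶜ) (hms X₁) (measure_ne_top _ _)
    rw [Set.sdiff_eq] at e
    have e' : Y ∩ X₀ᶜ ∩ X₁ = Y ∩ X₁ ∩ X₀ᶜ := by
      ext ω; simp only [Set.mem_inter_iff]; tauto
    rw [e'] at e
    linarith
  -- the capture hypothesis in the local notation
  have hcap' : μ.real V₀ + ∑ W ∈ 𝒟, max (min (f₀ W) (f₁ W) - f₂ W) 0 ≤ μ.real (Y ∩ X₀ᶜ ∩ X₁ᶜ) := hcap
  -- combine
  have hsumR₁₀ : ∑ W ∈ R₁, μ.real ({ω : BondConfig (Fin n) | ∀ z : Fin n, (z ∈ W ↔ ω ∈ ⋃ s ∈ S, openConn s z)} ∩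
      openConn a₀ b) = ∑ W ∈ R₁, f₀ W := rfl
  have hsumR₁₁ : ∑ W ∈ R₁, μ.real ({ω : BondConfig (Fin n) | ∀ z : Fin n, (z ∈ W ↔ ω ∈ ⋃ s ∈ S, openConn s z)} ∩
      openConn a₁ b) = ∑ W ∈ R₁, f₁ W := rfl
  rw [hsumR₁₀, hsumR₁₁] at hsand₁
  simp only [hKW, h𝒟] at hsum1
  linarith [hsum1, hP3, hτ, hYd, hQ3, hA1, hU₁, hsand₁, hS8, d1, hcap']

end BlockGoodThreeRelaysCapture

open Literature.Probability.LatticeModels Literature.Probability.Percolation in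
/-- Registered helper stub `stub_blockGoodThreeRelaysCapture_v1357` (ttrl deep seat V1357): **the three-relay residual kernel
under capture control of one relay** (= `blockGood_threeRelays_of_captureControl`, ∀-form).
[cite: KozmaNitzan2024, §3.2 (Definition p. 12, Question 7 p. 36), Lemma 3 (pp. 6–7)] -/
theorem stub_blockGoodThreeRelaysCapture_v1357 : ∀ (n : ℕ) (u : Sym2 (Fin n) → unitInterval) (A S : Finset (Fin n)) (b a₀ a₁ a₂ : Fin n) (sel : Finset (Fin n) → Fin n), b ∈ A → a₀ ∈ A → a₁ ∈ A → a₂ ∈ A → (∀ a ∈ A, a = a₀ ∨ a = a₁ ∨ a = a₂ ∨ a = b) → S.Nonempty → (∀ W, sel W ∈ A) → (∀ a ∈ A, (prodBernoulli u).real (openConn a₀ b) ≤ (prodBernoulli u).real (openConn a b)) → (prodBernoulli u).real (openConn a₁ b ∩ (⋃ s ∈ S, openConn s b)ᶜ ∩ (⋃ s ∈ S, openConn s a₂) ∩ (⋃ s ∈ S, openConn s a₁)ᶜ ∩ (⋃ s ∈ S, openConn s a₀)ᶜ) + ∑ W ∈ (Finset.univ : Finset (Finset (Fin n))).filter (fun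 W => Disjoint W A), max (min ((prodBernoulli u).real ({ω : BondConfig (Fin n) | ∀ z : Fin n, (z ∈ W ↔ ω ∈ ⋃ s ∈ S, openConn s z)} ∩ openConn a₀ b)) ((prodBernoulli u).real ({ω : BondConfig (Fin n) | ∀ z : Fin n, (z ∈ W ↔ ω ∈ ⋃ s ∈ S, openConn s z)} ∩ openConn a₁ b)) - (prodBernoulli u).real ({ω : BondConfig (Fin n) | ∀ z : Fin n, (z ∈ W ↔ ω ∈ ⋃ s ∈ S, openConn s z)} ∩ openConn a₂ b)) 0 ≤ (prodBernoulli u).real ((⋃ s ∈ S, openConn s b) ∩ (⋃ s ∈ S, openConn s a₀)ᶜ ∩ (⋃ s ∈ S, openConn s a₁)ᶜ) → (prodBernoulli u).real (openConn a₀ b) + (prodBernoulli u).real ((openConn a₀ b)ᶜ ∩ (⋃ s ∈ S, openConn a₀ s) ∩ (⋃ s ∈ S, openConn s b)) ≤ (prodBernoulli u).real (⋃ s ∈ S, openConn s b) + ∑ W ∈ (Finset.univ : Finset (Finset (Fin n))).filter (fun W => Disjoint W A), (prodBernoulli u).real {ω : BondConfig (Fin n) | ∀ z : Fin n, (z ∈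 W ↔ ω ∈ ⋃ s ∈ S, openConn s z)} * (prodBernoulli u).real (openConnIn ((W : Set (Fin n))ᶜ) (sel W) b) :=
  fun _ u A S b a₀ a₁ a₂ sel hbA ha₀ ha₁ ha₂ hA hS hsel hmin hcap =>
    blockGood_threeRelays_of_captureControl u A S b a₀ a₁ a₂ sel hbA ha₀ ha₁ ha₂ hA hS hsel hmin hcap

end

end Summit.CriticalPhenomena.PercolationContinuityZ3.Theorems
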